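import Summits.Ventures.HodgeRepro2.T5SU11KernelTwoSidedBound
import Summits.Ventures.HodgeRepro2.T5SU11ReductionOfOrderOrigin

/-!
# The corner singularity of the kernel: `χ_λ(t) → +∞` and `K_λ(t, t) → −∞` as `t → 0⁺`; row 600's bound cannot reach the corner

Row 444 showed that the second solution `ψ_λ = φ_λ · ∫_1^t ds/(sinh 2s φ_λ²)` tends to `−∞` logarithmically as `t → 0⁺`
(`tendsto_secondSolution_nhdsGT_zero`, `secondSolution_le_log`), and row 447 wrote the decaying solution as
`χ_λ = J φ_λ − ψ_λ` with `J = ∫_1^∞ ds/(sinh 2s φ_λ²) ≥ 0` (`sphDecay_eq`). Hence: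

* `exists_sph_hyp_bounds_Ioc` — `0 < m ≤ φ_λ ≤ M` on `(0, 1]` (compactness);
* `sphDecay_ge_neg_log` — **`χ_λ(t) ≥ c · log(1/t)` for `0 < t < 1`**, `c = m/(2 cosh 2 · M²) > 0`;
* `tendsto_sphDecay_nhdsGT_zero` — **`χ_λ(t) → +∞` as `t → 0⁺`**;
* `kernel_diagonal_le_neg_log`, `tendsto_kernel_diagonal_nhdsGT_zero` — **`K_λ(t, t) ≤ −m c log(1/t) → −∞`**: the kernel has the
  logarithmic singularity of the hyperbolic plane's Green's function on the diagonal at the origin;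
* `not_exists_abs_kernel_le_mul_sph_one` — **no bound `|K_λ(t, s)| ≤ C Ξ(t) Ξ(s)` holds on all of `(0, ∞)²`**: row 600's two-sided
  bound on `{max(t, s) ≥ a}` is sharp in that the restriction `a > 0` cannot be dropped.

Nothing is claimed about (N).

Blind lane: Mathlib + the HodgeRepro2 prefix only; no sorry; axioms ⊆ {propext, Classical.choice,
Quot.sound}.
-/

namespace Summit.Ventures.HodgeRepro2.T5SU11KernelCornerSingularity

open Filter Topology MeasureTheory
open Set (Ioi Ioc Icc)
open T5SU11Cartan T5SU11SphericalFunction T5SU11SphericalBounds T5SU11SphericalContinuous T5SU11SphericalDecay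
  T5SU11SphericalSolutionSpaceAll T5SU11ReductionOfOrder T5SU11ReductionOfOrderOrigin T5SU11RadialGreenKernel
  T5SU11RadialGreenImproperOrigin T5SU11KernelTwoSidedBound

section measure

variable [MeasurableSpace Circle] [BorelSpace Circle]

/-- **`0 < m ≤ φ_λ ≤ M` on `(0, 1]`**: the spherical function is bounded above and below by positive constants near the
origin (compactness of `[0, 1]`). -/
theorem exists_sph_hyp_bounds_Ioc (lam : ℝ) :
    ∃ m M : ℝ, 0 < m ∧ (∀ s, 0 < s → s ≤ 1 → m ≤ sph lam (hyp s)) ∧ ∀ s, 0 < s → s ≤ 1 → sph lam (hyp s) ≤ M := by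
  obtain ⟨s₀, _, hmin⟩ := isCompact_Icc.exists_isMinOn (Set.nonempty_Icc.mpr zero_le_one)
    (continuous_sph_hyp lam).continuousOn
  obtain ⟨Φ, _, hΦ⟩ := exists_sph_hyp_le lam
  refine ⟨sph lam (hyp s₀), Φ, sph_hyp_pos lam s₀, fun s hs0 hs1 => ?_, fun s hs0 hs1 => hΦ s ⟨hs0.le, hs1⟩⟩
  exact (isMinOn_iff.mp hmin) s ⟨hs0.le, hs1⟩

variable {lam : ℝ} (hlam : 1 < lam)

/-- `J = ∫_1^∞ ds/(sinh 2s · φ_λ(a_s)²) ≥ 0`. -/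
theorem roIntegral_tail_nonneg (lam : ℝ) : 0 ≤ ∫ s in Ioi 1, roIntegrand (fun t => sph lam (hyp t)) s := by
  refine setIntegral_nonneg measurableSet_Ioi (fun s hs => ?_)
  unfold roIntegrand
  have h1 : 0 < Real.sinh (2 * s) := sinh_two_mul_pos (lt_trans one_pos hs)
  have h2 : 0 < sph lam (hyp s) := sph_hyp_pos lam s
  positivity

include hlam in
/-- **`χ_λ(t) ≥ −ψ_λ(t)`** for `t > 0`: the decaying solution dominates the negative of the second solution. -/
theorem neg_sphSecond_le_sphDecay {t : ℝ} (ht : 0 < t) : -sphSecond lam t ≤ sphDecay lam t := by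
  rw [sphDecay_eq hlam ht]
  have hJ := roIntegral_tail_nonneg lam
  have hφ : 0 ≤ sph lam (hyp t) := (sph_hyp_pos lam t).le
  nlinarith [mul_nonneg hJ hφ]

include hlam in
/-- **`χ_λ(t) ≥ c · log(1/t)` for `0 < t < 1`** with `c = m/(2 cosh 2 · M²) > 0`, `m, M` the bounds of `φ_λ` on `(0, 1]`: the
decaying solution has (at least) the logarithmic singularity of the hyperbolic plane's Green's function at the origin. -/
theorem sphDecay_ge_neg_log :
    ∃ c : ℝ, 0 < c ∧ ∀ t, 0 < t → t < 1 → c * (-Real.log t) ≤ sphDecay lam t := by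
  obtain ⟨m, M, hm0, hm, hM⟩ := exists_sph_hyp_bounds_Ioc lam
  have hM0 : 0 < M := lt_of_lt_of_le (sph_hyp_pos lam 1) (hM 1 one_pos le_rfl)
  have hK : 0 < 2 * Real.cosh 2 * M ^ 2 := by
    have := Real.cosh_pos 2
    positivity
  refine ⟨m / (2 * Real.cosh 2 * M ^ 2), by positivity, fun t ht0 ht1 => ?_⟩
  have hψ : sphSecond lam t ≤ m * (Real.log t / (2 * Real.cosh 2 * M ^ 2)) :=
    secondSolution_le_log (hφ_sph lam) (hpos_sph lam) hm hM hm0 ht0 ht1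
  have hχ := neg_sphSecond_le_sphDecay hlam ht0
  have e : m / (2 * Real.cosh 2 * M ^ 2) * (-Real.log t) = -(m * (Real.log t / (2 * Real.cosh 2 * M ^ 2))) := by
    ring
  rw [e]
  linarith

include hlam in
/-- **`χ_λ(t) → +∞` as `t → 0⁺`.** -/
theorem tendsto_sphDecay_nhdsGT_zero : Tendsto (sphDecay lam) (𝓝[>] 0) atTop := by
  obtain ⟨m, M, hm0, hm, hM⟩ := exists_sph_hyp_bounds_Ioc lam
  have hψ : Tendsto (sphSecond lam) (𝓝[>] 0) atBot :=
    tendsto_secondSolution_nhdsGT_zero (hφ_sph lam) (hpos_sph lam) hm hM hm0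
  have hneg : Tendsto (fun t => -sphSecond lam t) (𝓝[>] 0) atTop := tendsto_neg_atTop_iff.mpr hψ
  refine tendsto_atTop_mono' (𝓝[>] 0) ?_ hneg
  exact eventually_nhdsWithin_of_forall (fun t ht => neg_sphSecond_le_sphDecay hlam ht)

include hlam in
/-- **The kernel on the diagonal**: `K_λ(t, t) = −φ_λ(a_t) χ_λ(t) ≤ −m c log(1/t)` for `0 < t < 1`. -/
theorem kernel_diagonal_le_neg_log :
    ∃ c : ℝ, 0 < c ∧ ∀ t, 0 < t → t < 1 → sphGreenKernel lam t t ≤ -(c * (-Real.log t)) := by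
  obtain ⟨m, M, hm0, hm, _⟩ := exists_sph_hyp_bounds_Ioc lam
  obtain ⟨c, hc, hc'⟩ := sphDecay_ge_neg_log hlam
  refine ⟨m * c, mul_pos hm0 hc, fun t ht0 ht1 => ?_⟩
  have hχ := hc' t ht0 ht1
  have hχ0 : 0 < sphDecay lam t := sphDecay_pos hlam ht0
  have hlog : 0 ≤ -Real.log t := by
    have := Real.log_neg ht0 ht1
    linarith
  have hφ := hm t ht0 ht1.le
  unfold sphGreenKernel greenKernel
  rw [min_self, max_self]
  have : m * c * (-Real.log t) ≤ sph lam (hyp t) * sphDecay lam t := by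
    calc m * c * (-Real.log t) = m * (c * (-Real.log t)) := by ring
      _ ≤ m * sphDecay lam t := mul_le_mul_of_nonneg_left hχ hm0.le
      _ ≤ sph lam (hyp t) * sphDecay lam t := mul_le_mul_of_nonneg_right hφ hχ0.le
  linarith

include hlam in
/-- **`K_λ(t, t) → −∞` as `t → 0⁺`**: the kernel is unbounded at the corner. -/
theorem tendsto_kernel_diagonal_nhdsGT_zero : Tendsto (fun t => sphGreenKernel lam t t) (𝓝[>] 0) atBot := by
  obtain ⟨m, M, hm0, hm, _⟩ := exists_sph_hyp_bounds_Ioc lam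
  have hχ := tendsto_sphDecay_nhdsGT_zero hlam
  -- `−K_λ(t, t) = φ_λ(a_t) χ_λ(t) ≥ m χ_λ(t)` for `0 < t ≤ 1`
  have hmul : Tendsto (fun t => m * sphDecay lam t) (𝓝[>] 0) atTop := Filter.Tendsto.const_mul_atTop hm0 hχ
  have hle : ∀ᶠ t in 𝓝[>] (0 : ℝ), m * sphDecay lam t ≤ -sphGreenKernel lam t t := by
    have h1 : ∀ᶠ t in 𝓝[>] (0 : ℝ), t ∈ Ioi (0 : ℝ) := self_mem_nhdsWithin
    have h2 : ∀ᶠ t in 𝓝[>] (0 : ℝ), t < 1 := eventually_nhdsWithin_of_eventually_nhds (eventually_lt_nhds one_pos)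
    filter_upwards [h1, h2] with t ht ht1
    have hχ0 : 0 < sphDecay lam t := sphDecay_pos hlam ht
    have hφ := hm t ht ht1.le
    unfold sphGreenKernel greenKernel
    rw [min_self, max_self, neg_neg]
    exact mul_le_mul_of_nonneg_right hφ hχ0.le
  have hneg : Tendsto (fun t => -sphGreenKernel lam t t) (𝓝[>] 0) atTop := tendsto_atTop_mono' _ hle hmul
  exact tendsto_neg_atTop_iff.mp hneg

include hlam in
/-- **ROW 600'S BOUND CANNOT REACH THE CORNER**: there is no constant `C` with `|K_λ(t, s)| ≤ C Ξ(t) Ξ(s)` for ALL `t, s > 0`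
(`Ξ ≤ 1` while `|K_λ(t, t)| → ∞` as `t → 0⁺`). -/
theorem not_exists_abs_kernel_le_mul_sph_one :
    ¬ ∃ C : ℝ, ∀ t s, 0 < t → 0 < s → |sphGreenKernel lam t s| ≤ C * (sph 1 (hyp t) * sph 1 (hyp s)) := by
  rintro ⟨C, hC⟩
  have h := tendsto_kernel_diagonal_nhdsGT_zero hlam
  -- eventually `K_λ(t, t) < −|C| − 1`
  have hev : ∀ᶠ t in 𝓝[>] (0 : ℝ), sphGreenKernel lam t t < -|C| - 1 := h.eventually (eventually_lt_atBot _)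
  obtain ⟨t, ht, hlt⟩ := (hev.and self_mem_nhdsWithin).exists
  have ht0 : 0 < t := hlt
  have hb := hC t t ht0 ht0
  have hΞ : sph 1 (hyp t) ≤ 1 := sph_hyp_le_one zero_le_one one_le_two t
  have hΞ0 : 0 < sph 1 (hyp t) := sph_hyp_pos 1 t
  have hCabs : C * (sph 1 (hyp t) * sph 1 (hyp t)) ≤ |C| := by
    calc C * (sph 1 (hyp t) * sph 1 (hyp t)) ≤ |C| * (sph 1 (hyp t) * sph 1 (hyp t)) :=
          mul_le_mul_of_nonneg_right (le_abs_self C) (by positivity)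
      _ ≤ |C| * 1 := mul_le_mul_of_nonneg_left (by nlinarith) (abs_nonneg C)
      _ = |C| := mul_one _
  have hC0 : 0 ≤ |C| := abs_nonneg C
  have habs : |C| + 1 < |sphGreenKernel lam t t| := by
    rw [abs_of_neg (show sphGreenKernel lam t t < 0 by linarith)]
    linarith
  linarith

end measure

end Summit.Ventures.HodgeRepro2.T5SU11KernelCornerSingularity
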